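import Summits.ValiantsHypothesis.ValiantsHypothesis.Theorems.LacunarySymmetroidMatrixDescartesCensusV19SCheck

/-!
# `MatrixDescartes` census — the 2-SIDON `V = 19` checker with GENERAL WINDOW rows (`V19G`; definitions)

HONEST FRAMING.  Object-search cell `pub-symmetroid`; door-A item `DoorA26 = PosRootLawAt 2 6 19` (stmt-ValiantsHypothesis-19979; OPEN, typed,
never asserted) and its sharper support rows `PosRootLawOn 2 6 18 d`.  DEFINITIONS ONLY: a certificate language and Boolean checker that EXTEND
door-p4 g5's `…CensusV19SCheck` (imported UNCHANGED: contexts `V19S.Ctx`, modes, the rows `c25 / win / one / amgm`, the sign / all-negative checks,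
the slices) by ONE row kind, the GENERAL WINDOW ROW `gwin W p q r` of val-sym-door-p5 g5 (lemma `Census.window4_balance_support`,
`…CensusGeneralWindow`): in mode `A k`, for ANY four positions `W = [a < b < e < f]` (not necessarily consecutive, not necessarily through the
repetition) the Euler twists at the `17` sums outside `W` leave a four-term exponential sum with a positive root, so the four TWISTED terms
`σ_t · x_t · P_t · y^{E_t}` balance at some `y > 0` (`P_t = ∏_{u ∉ W} |E_t − E_u|` the REDUCED weight = `V19S.redW` with the window's sums,
`σ_t` = the cell sign of `t` times `(−1)^{#{u ∉ W : E_u > E_t}}` — `twistNeg`); when exactly one position `q ∈ {b, e}` carries the minority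
twisted sign (`gwinSpec`), the term of `q` dominates the other three, and for `p < q < r` in `W` weighted AM–GM gives the row
`D^D (P_p x_p)^{D₂} (P_r x_r)^{D₁} ≤ D₁^{D₁} D₂^{D₂} (P_q x_q)^D` (`rowGWin`; `D₁ = E_q − E_p`, `D₂ = E_r − E_q`) — the shape of `V19S.rowWin` with
`φ = 1` and an arbitrary window.  The consecutive windows through the repetition reproduce `V19S`'s `win` rows; windows of type (1,3)/(3,1) across
the repetition give rows strictly stronger than `c25`.  Certificates `V19G.Cert0 / Cert` are `V19S`'s with row lists over `V19G.GRow`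
(`base r` = a `V19S.RowSpec`, or `gwin`); `checkCells` has `V19S.checkCells`'s shape (eight slices per support).  Semantics and soundness:
`…CensusV19GModel`, `…CensusV19GSound*`.  Nothing here bears on the one-collision supports, on `ζ_sym(2,6)` over all supports, on `MatrixDescartes`
(stmt-ValiantsHypothesis-18050) or on `VP ≠ VNP`.

[folklore] Bookkeeping / certificate replay; elementary.
-/

-- the D-0017 layout repeats a namespace component (single-conjunct summit); the `dupNamespace` linter flags it; name mandated.
set_option linter.dupNamespace false

namespace Summit.ValiantsHypothesis.ValiantsHypothesis.Theorems.LacunarySymmetroidMatrixDescartes.Census.V19G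

open V20 (Atom allAtoms sortAtoms ordOK sums Term PolySpec posl FNat Row mulF divF numZ denZ accumulate bumps)
open V19S (Mode Ctx mkCtx negSlot termZero termNeg posTerms defOK RowSpec buildRow redW signOK signNullOK allnegOK sliceA sliceB)

/-! ## The general window row -/

/-- Number of sums of `E` outside the window sums `Ws` and above `e` (the parity of the twist sign at `e`). [folklore] -/
def aboveOut (E Ws : List ℕ) (e : ℕ) : ℕ := (E.filter fun u => decide (e < u) && !decide (u ∈ Ws)).length

/-- Is the TWISTED term of position `t` negative for the window with sums `Ws`?  (cell sign of `t`, flipped once for every sum outside the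
window above `E_t`: the sign of `c_t · ∏_{u ∉ W} (E_t − E_u)`). [folklore] -/
def twistNeg (c : Ctx) (Ws : List ℕ) (t : ℕ) : Bool :=
  xor (negSlot c.s c.mode t) (aboveOut c.E Ws (c.E.getD t 0) % 2 == 1)

/-- The sums of a window of positions. [folklore] -/
def wsums (E W : List ℕ) : List ℕ := W.map fun t => E.getD t 0

/-- Admissibility of the general window row `gwin W p q r`: mode `A k` (`k < 20`), `W = [a < b < e < f]` positions `< 21`, `p < q < r` in `W`
with `q ∈ {b, e}` (bracketed), and `q` is the UNIQUE position of `W` with its twisted sign (the lone term of the balance). [folklore] -/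
def gwinSpec (c : Ctx) (W : List ℕ) (p q r : ℕ) : Bool :=
  match c.mode, W with
  | .A k, [a, b, e, f] =>
    decide (k < 20 ∧ a < b ∧ b < e ∧ e < f ∧ f < 21 ∧ p < q ∧ q < r ∧ (p = a ∨ p = b ∨ p = e) ∧ (q = b ∨ q = e) ∧ (r = b ∨ r = e ∨ r = f)) &&
      [a, b, e, f].all fun t => (t == q) || (twistNeg c (wsums c.E W) t != twistNeg c (wsums c.E W) q)
  | _, _ => false

/-- The general window row `D^D (P_p x_p)^{D₂} (P_r x_r)^{D₁} ≤ D₁^{D₁} D₂^{D₂} (1·P_q x_q)^D` with the REDUCED weights of the window sums `Ws`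
(`V19S.redW`), `D₁ = E_q − E_p`, `D₂ = E_r − E_q` — the shape of `V19S.rowWin` with `φ = 1`. [folklore] -/
def rowGWin (E Ws : List ℕ) (p q r : ℕ) : Row :=
  let ep := E.getD p 0
  let eq := E.getD q 0
  let er := E.getD r 0
  let D1 := eq - ep
  let D2 := er - eq
  { L := List.replicate D2 p ++ List.replicate D1 r
    R := List.replicate (D1 + D2) q
    Bnum := redW E Ws eq (D1 + D2) ++ [(1, D1 + D2), (D1, D1), (D2, D2)]
    Bden := redW E Ws ep D2 ++ redW E Ws er D1 ++ [(D1 + D2, D1 + D2)] }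

/-- Row specifications of `V19G`: a `V19S` row, or a general window row through positions `p < q < r` of the window `W` (four positions). [folklore] -/
inductive GRow where
  /-- a row of the `V19S` checker (`c25`, `win`, `one`, `amgm`) -/
  | base (r : RowSpec)
  /-- general window row: window `W` (positions), trinomial `p < q < r ⊆ W`, `q` the lone twisted sign -/
  | gwin (W : List ℕ) (p q r : ℕ)

/-- Build a row from its specification, checking its side conditions. [folklore] -/
def buildRow (c : Ctx) : GRow → Option Row
  | .base r => V19S.buildRow c r
  | .gwin W p q r => if gwinSpec c W p q r then some (rowGWin c.E (wsums c.E W) p q r) else none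

/-- Build all rows of a list of specifications (with multipliers); `none` if one is invalid. [folklore] -/
def buildRows (c : Ctx) : List (GRow × ℕ) → Option (List (Row × ℕ))
  | [] => some []
  | (rs, n) :: rest =>
    match buildRow c rs, buildRows c rest with
    | some r, some rr => some ((r, n) :: rr)
    | _, _ => none

/-! ## Certificates -/

/-- A competitor of a domination certificate (as `V19S.Comp`, rows over `GRow`). [folklore] -/
structure Comp where
  /-- index of the positive term -/
  k : ℕ
  /-- rows with multipliers -/
  rows : List (GRow × ℕ)
  /-- root degree -/
  D : ℕ
  /-- numerator of the bound -/
  un : ℕ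

/-- Leaf certificates that a cell carries no nineteen (as `V19S.Cert0`, rows over `GRow`). [folklore] -/
inductive Cert0 where
  /-- odd triangle through three definite letters `i < j < k` -/
  | sign (i j k : ℕ)
  /-- odd triangle through the NULL letter `n` and definite letters `a < b` -/
  | signNull (n a b : ℕ)
  /-- every non-zero term of the inequality `P ≥ 0` is negative -/
  | allneg (P : PolySpec)
  /-- Farkas combination of rows -/
  | lp (rows : List (GRow × ℕ))
  /-- single-monomial domination of `P ≥ 0`: negative term `n0`, common denominator `ud`, competitors -/
  | dom (P : PolySpec) (n0 : ℕ) (ud : ℕ) (comps : List Comp)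

/-- Certificates: a leaf, or the middle-window disjunction of `V19S` with one leaf per branch. [folklore] -/
inductive Cert where
  /-- a leaf certificate -/
  | leaf (ct : Cert0)
  /-- `2·max(middle terms) ≥ outer sum`: `cK` with the `k`-th, `cK1` with the `(k+1)`-th middle term doubled -/
  | branch2 (cK cK1 : Cert0)

/-- Check an LP (Farkas) certificate: balance of exponents and `∏ Bden^N > ∏ Bnum^N`. [folklore] -/
def lpOK (c : Ctx) (rows : List (GRow × ℕ)) : Bool :=
  match buildRows c rows with
  | none => false
  | some rs =>
    let acc := accumulate rs
    decide (acc.1 = acc.2.1) && decide (denZ acc.2.2 < numZ acc.2.2)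

/-- Check one competitor of a domination certificate. [folklore] -/
def compOK (c : Ctx) (P : List Term) (n0 ud : ℕ) (cp : Comp) : Bool :=
  match buildRows c cp.rows with
  | none => false
  | some rs =>
    let acc := accumulate rs
    let T0 := P.getD n0 (0, [])
    let Tk := P.getD cp.k (0, [])
    let A := divF (mulF acc.2.2 [(cp.un * T0.1.natAbs, cp.D)] 1) [(Tk.1.natAbs * ud, cp.D)] 1
    decide (0 < cp.D) && decide (0 < cp.un) &&
      decide (bumps acc.1 (posl c.ord T0.2) cp.D = bumps acc.2.1 (posl c.ord Tk.2) cp.D) &&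
      decide (denZ A ≤ numZ A)

/-- Check a domination certificate. [folklore] -/
def domOK (c : Ctx) (P : PolySpec) (n0 ud : ℕ) (comps : List Comp) : Bool :=
  let poly := P.poly
  let pos := posTerms c poly
  P.valid && defOK c P && decide (n0 < poly.length) && !termZero c (poly.getD n0 (0, [])) && termNeg c (poly.getD n0 (0, [])) &&
    decide (0 < ud) &&
    decide (∀ k ∈ pos, ∃ cp ∈ comps, cp.k = k) && decide (∀ cp ∈ comps, cp.k ∈ pos) &&
    decide ((comps.map Comp.k).Nodup) &&
    decide ((comps.map Comp.un).sum < ud) &&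
    comps.all (compOK c poly n0 ud)

/-- Check a leaf certificate for a cell. [folklore] -/
def cert0OK (c : Ctx) : Cert0 → Bool
  | .sign i j k => signOK c i j k
  | .signNull n a b => signNullOK c n a b
  | .allneg P => allnegOK c P
  | .lp rows => lpOK c rows
  | .dom P n0 ud comps => domOK c P n0 ud comps

/-- Check a certificate for a cell: a leaf, or (mode A with a middle window) one leaf per branch of the disjunction. [folklore] -/
def certOK (c : Ctx) : Cert → Bool
  | .leaf ct => cert0OK c ct
  | .branch2 cK cK1 =>
    match c.mode with
    | .A k => decide (1 ≤ k ∧ k + 2 ≤ 20) && cert0OK { c with mid := some k } cK && cert0OK { c with mid := some (k + 1) } cK1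
    | .B _ => false

/-! ## Cells and slices -/

/-- Check the certificates of a list of cells `(s, mode)` against their contexts (branch `none`). [folklore] -/
def cellsOK (d : List ℕ) (ord : List Atom) : List (Bool × Mode) → List Cert → Bool
  | [], [] => true
  | (s, m) :: sm, ct :: cs => m.ok && certOK (mkCtx d ord s m none) ct && cellsOK d ord sm cs
  | _, _ => false

/-- Check a slice of cells of a support: compute and verify the 2-Sidon order, then every listed cell. [folklore] -/
def checkCells (d : List ℕ) (L : List (Bool × Mode)) (certs : List Cert) : Bool :=
  let ord := sortAtoms d
  ordOK d ord && cellsOK d ord L certs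

end Summit.ValiantsHypothesis.ValiantsHypothesis.Theorems.LacunarySymmetroidMatrixDescartes.Census.V19G
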